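import Mathlib

/-!
# DEQ-A237 receipt — a cubic form bounded by a quadratic one vanishes (scope of the hypothesis `β_P < 1`, eq. (81))

HONEST FRAMING: instance-level adjudication of specific advantage claims; no claim about
BQP vs BPP or the summit.

Staging copy `pub-qadeq-deq-1/EnergyNeutralQuadratic.lean` of unit pub-qadeq-deq-1 (gen 38), for the
note `pub-qadeq-deq-1/DEQ-A237.md` on Li–Catli–Lim–Pocrnic–An–Liu–Wiebe, *Efficient Quantum
Simulation for Nonlinear Stochastic Differential Equations*, arXiv:2603.12398v1 (bib key
`LiEtAl2026NSDE`).  Nothing of that paper's algorithm, probability theory or complexity statements is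
formalised here.  What is checked is the elementary scaling fact behind the note's scope finding (F):

Lemma 22 of the paper (eq. (81)) assumes, for the quadratic coefficient
`F₂ : ℂ^{n²} → ℂⁿ` (linear), solutions `x(t) ∈ ℂⁿ` and a positive-definite Hermitian weight `P`, that
`β_P := sup_{x ≠ 0} Re⟨x, F₂(x ⊗ x)⟩_P / ‖x‖_P² < 1` (held text chunk p0022 = printed p. 18).
The numerator `c(x) = ⟨x, F₂(x ⊗ x)⟩_P` is homogeneous of degree three along every line
(`c(t x) = t³ c(x)` for all real `t`) while the denominator is homogeneous of degree two, so a finite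
`β_P` (a fortiori `β_P < 1`) forces `c ≡ 0` — the quadratic term is `P`-energy-neutral and then `β_P = 0`.  Hence the
results proved under (81) (Lemmas 22–24, Corollary 25, Theorem 26 = Result 1) are exactly the
energy-neutral case, which the paper itself names on p. 21 ('generally fails unless the quadratic
drift is energy-neutral (β_P = 0)').

* `eq_zero_of_cubic_le_quadratic` — over any real vector space: if `c(t • x) = t³ c x`,
  `g(t • x) = t² g x`, `0 ≤ g` and `c ≤ β g` pointwise for some real `β`, then `c = 0`;
* `eq_zero_of_cubic_le_mul_norm_sq` — the case `g = ‖·‖²` on a real normed space;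
* `inner_eq_zero_of_two_homogeneous` — the case `c x = ⟪x, Q x⟫` for a degree-two homogeneous
  map `Q` (in the application `Q x = P F₂(x ⊗ x)` for the Euclidean inner product, or
  `Q x = F₂(x ⊗ x)` for the `P`-inner product) on a real inner-product space: a bound
  `⟪x, Q x⟫ ≤ β ‖x‖²` forces `⟪x, Q x⟫ = 0` for every `x`;
* `re_inner_eq_zero_of_two_homogeneous` — the same over a COMPLEX inner-product space with real
  scaling `t : ℝ ↦ (t : ℂ) • x`, i.e. literally the shape of (81) (`x ∈ ℂⁿ`, `Re ⟨·,·⟩_P`): the bound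
  `Re ⟪x, Q x⟫ ≤ β ‖x‖²` for ANY real `β` (the paper asks `β_P < 1`) forces `Re ⟪x, Q x⟫ ≡ 0`, so
  `β_P < 1 ⇔ β_P = 0 ⇔` energy-neutral.
-/

namespace Summit.QuantumAdvantage.Dequantization.EnergyNeutralQuadratic

/-- A function that is homogeneous of degree three along lines and bounded above by `β` times a
non-negative function homogeneous of degree two vanishes identically. -/
theorem eq_zero_of_cubic_le_quadratic {E : Type*} [AddCommGroup E] [Module ℝ E]
    (c g : E → ℝ) (hc : ∀ (t : ℝ) (x : E), c (t • x) = t ^ 3 * c x)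
    (hg : ∀ (t : ℝ) (x : E), g (t • x) = t ^ 2 * g x) (hg0 : ∀ x, 0 ≤ g x)
    (β : ℝ) (hβ : ∀ x, c x ≤ β * g x) : ∀ x, c x = 0 := by
  -- Step 1: `c ≤ 0` everywhere (scale a putative positive value up along the ray).
  have key : ∀ x, c x ≤ 0 := by
    intro x
    by_contra h0
    have h : 0 < c x := lt_of_not_ge h0
    set t : ℝ := (|β| * g x + 1) / c x with ht
    have tpos : 0 < t := by
      rw [ht]; exact div_pos (by nlinarith [hg0 x, abs_nonneg β]) h
    have h1 := hβ (t • x)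
    rw [hc, hg] at h1
    have h2 : t * c x = |β| * g x + 1 := by
      rw [ht]; field_simp
    have h3 : t ^ 3 * c x = t ^ 2 * (|β| * g x + 1) := by
      rw [← h2]; ring
    have h4 : β * (t ^ 2 * g x) ≤ |β| * (t ^ 2 * g x) :=
      mul_le_mul_of_nonneg_right (le_abs_self β) (by nlinarith [hg0 x, sq_nonneg t])
    have h5 : t ^ 2 * (|β| * g x + 1) ≤ |β| * (t ^ 2 * g x) := by
      rw [← h3]; exact h1.trans h4
    nlinarith [pow_pos tpos 2, hg0 x, abs_nonneg β]
  -- Step 2: apply Step 1 to `x` and to `-x = (-1) • x` and use oddness.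
  intro x
  have h1 := key x
  have h2 := key ((-1 : ℝ) • x)
  rw [hc] at h2
  norm_num at h2
  linarith

/-- The normed-space case: a degree-three homogeneous `c` with `c x ≤ β ‖x‖²` vanishes. -/
theorem eq_zero_of_cubic_le_mul_norm_sq {E : Type*} [NormedAddCommGroup E] [NormedSpace ℝ E]
    (c : E → ℝ) (hc : ∀ (t : ℝ) (x : E), c (t • x) = t ^ 3 * c x)
    (β : ℝ) (hβ : ∀ x, c x ≤ β * ‖x‖ ^ 2) : ∀ x, c x = 0 :=
  eq_zero_of_cubic_le_quadratic c (fun x => ‖x‖ ^ 2) hc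
    (by
      intro t x
      rw [norm_smul, Real.norm_eq_abs, mul_pow, sq_abs])
    (fun x => by positivity) β hβ

/-- The inner-product case used in the note: if `Q` is homogeneous of degree two
(`Q (t • x) = t² • Q x`, e.g. `Q x = F₂(x ⊗ x)` composed with a linear weight) and
`⟪x, Q x⟫ ≤ β ‖x‖²` for all `x`, then `⟪x, Q x⟫ = 0` for all `x`: the quadratic term is
energy-neutral, so the supremum `β_P` of (81) is `0` whenever it is finite. -/
theorem inner_eq_zero_of_two_homogeneous {E : Type*} [NormedAddCommGroup E]
    [InnerProductSpace ℝ E] (Q : E → E) (hQ : ∀ (t : ℝ) (x : E), Q (t • x) = t ^ 2 • Q x)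
    (β : ℝ) (hβ : ∀ x, inner ℝ x (Q x) ≤ β * ‖x‖ ^ 2) : ∀ x, inner ℝ x (Q x) = 0 :=
  eq_zero_of_cubic_le_mul_norm_sq (fun x => inner ℝ x (Q x))
    (by
      intro t x
      simp only [hQ, real_inner_smul_left, real_inner_smul_right]
      ring) β hβ

/-- The complex case, literally the shape of hypothesis (81): `E` a complex inner-product space (in the
application `ℂⁿ` with the `P`-inner product), `Q` homogeneous of degree two under REAL scaling, and
`Re ⟪x, Q x⟫ ≤ β ‖x‖²` for all `x`.  Then `Re ⟪x, Q x⟫ = 0` for all `x`; in particular the supremum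
`β_P` in (81) is `< 1` (or merely finite) iff it is `0` iff the quadratic term is energy-neutral. -/
theorem re_inner_eq_zero_of_two_homogeneous {E : Type*} [NormedAddCommGroup E]
    [InnerProductSpace ℂ E] (Q : E → E)
    (hQ : ∀ (t : ℝ) (x : E), Q ((t : ℂ) • x) = ((t : ℂ) ^ 2) • Q x)
    (β : ℝ) (hβ : ∀ x, (inner ℂ x (Q x)).re ≤ β * ‖x‖ ^ 2) :
    ∀ x, (inner ℂ x (Q x)).re = 0 := by
  refine eq_zero_of_cubic_le_mul_norm_sq (E := E) (fun x => (inner ℂ x (Q x)).re) ?_ β hβ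
  intro t x
  have h1 : (t • x : E) = (t : ℂ) • x := (Complex.coe_smul t x).symm
  rw [h1, hQ, inner_smul_left, inner_smul_right, Complex.conj_ofReal]
  have h2 : (t : ℂ) * ((t : ℂ) ^ 2 * inner ℂ x (Q x)) = ((t ^ 3 : ℝ) : ℂ) * inner ℂ x (Q x) := by
    push_cast; ring
  rw [h2, Complex.re_ofReal_mul]

/-- Sanity converse (so the hypothesis is not vacuous): an energy-neutral `Q` satisfies the bound
with `β = 0`. -/
theorem bound_of_inner_eq_zero {E : Type*} [NormedAddCommGroup E] [InnerProductSpace ℝ E]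
    (Q : E → E) (h : ∀ x, inner ℝ x (Q x) = 0) : ∀ x, inner ℝ x (Q x) ≤ 0 * ‖x‖ ^ 2 := by
  intro x; rw [h x]; simp

end Summit.QuantumAdvantage.Dequantization.EnergyNeutralQuadratic
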